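import Summits.ABC.IUTFork.Conditional.RefBandsInhCells377933067B
import HarnessLib

/-!
# R-W «W:INH-BANDS-REFUTED-SIDE» (INH-REST), EXACT INHABITED LEVELS: the triple `3 ^ 3 * 241 ^ 3 + 5 ^ 8 * 11 ^ 9 * 19 * 61 ^ 3 = 2 ^ 15 * 17 ^ 2 * 331 * 1061 ^ 4` — the slot socket's `hcell` at the single primes
# `l ∈ {70039, 70051, 70061, 70067, 70079, 70099, 70111, 70117, 70121, 70123, 70139, 70141, 70157, 70163, 70177, 70181, 70183, 70199, 70201, 70207, 70223, 70229, 70237, 70241, 70249, 70271, 70289, 70297, 70309, 70313, 70321, 70327, 70351, 70373, 70379, 70381, 70393, 70423, 70429, 70439, 70451, 70457, 70459, 70481, 70487, 70489, 70501, 70507, 70529, 70537, 70549, 70571, 70573, 70583, 70589, 70607, 70619, 70621, 70627, 70639, 70657, 70663, 70667, 70687, 70709, 70717, 70729, 70753, 70769, 70783, 70793, 70823, 70841, 70843, 70849, 70853, 70867, 70877}` below the uniform threshold `70879` (part A of 2)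

PROOF-ONLY file (D-0012: 0 definitions, 0 `Prop` facts, no instance, no notation) of the abc-iut cell — D-0079 RESCUE sub-cell R-W «WINDOW Θ-SIDE
INEQUALITY», numerics-crew seat abc-iut-W-num-6 (gen 5), row INH-REST (abc-iut-plan g11 KEY `HOME/wake/KEY-abc-iut-W-num-6-INHREST.md`, follow-up
«exact-level INH addenda»; abc-iut-W-neg-1 g4's `InhUniformBandCellsFrey31117999167337103924704SixtySevenLevels` = the shape of record). GENERATED by
this seat's `work/inhlevels/emit_inhlevels.py` from the kernel-checked uniform cells `RefBandsInhCells377933067B` (gen 4, emit_inhband.py v2) and the desk census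
`work/inhlevels/check_levels.py` (exact integer cell, floor included, at every label / multiple; desk ≠ kernel — the kernel checks every inequality below).
CONTENT: at the binding prime `p = 1061` (`v_p(abc) = 4`, class `e ∈ 15·l·ℕ`, tame shape `D = e − 1`, slot `ρin = max(1, ⌊e/1060⌋)`, envelope exponent `1`)
the uniform floor-free certificate of `RefBand.inhcell_377933067_p1061` starts at `l = 70879`; at each level listed here it fails ONLY at the top label
`j = (l−1)/2` for the base multiple `n = 1`, where the EXACT cell (with the floor) still holds: (i) `n ≥ 2` — floor-free two-ends certificate at the base
multiple `2` (abc-iut-W-row-1's `WRow.cell_tameslot_of_ends`, slot `≥ 2·⌊15l/1060⌋`), every `l ≥ 33355`; (ii) `n = 1`, labels `j ≤ (l−3)/2` — the same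
certificate one label lower, every `l ≥ 66639`; (iii) `n = 1`, top label — `norm_num` on the closed integer cell, level by level. The other bad primes
are served by their uniform lemmas of `RefBandsInhCells377933067B` (own thresholds `≤ 4863`). Glue: `RefBand.inhcell_377933067_levels`.
The primes between the ∀T REF band/levels of record and `70879` that are NOT listed stay OPEN AS TYPED at the ∀T level under the slot reading
(`69991, 69997, 70001, 70003, 70009, 70019`): there the exact INH cell fails for some admissible `(e, j)` and the exact REF cell fails for some member.
HONEST SCOPE: integer arithmetic feeding typed sockets; nothing about the printed inequality; inhabited-as-typed ≠ true-in-print; no abc claim.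
[folklore] arithmetic. [cite: Mochizuki2012, IUTchIV Prop. 1.1 p. 9, Prop. 1.2 (i)(ii) p. 10, Prop. 1.4 (ii) p. 13] [cite: DupuyHilado2025, §3.3, §3.4]
[claim: Mochizuki2012, status: disputed] for the IUT locutions only.
-/

namespace Summit.ABC.IUTFork.Conditional
/-- The slot sockets' clause at the BINDING prime `p = 1061` (`v_p(abc) = 4`; `e ∈ 15·l·ℕ`; `D = e−1`, `ρin = ⌊e/1060⌋`, envelope exponent `1`)
at the EXACT LEVELS `l ∈ {70039, 70051, 70061, 70067, 70079, 70099, 70111, 70117, 70121, 70123, 70139, 70141, 70157}` (chunk 1; all below the uniform threshold `70879` of `RefBand.inhcell_377933067_p1061`): multiples `n ≥ 2` floor-free from the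
two end labels with base multiple `2` (`WRow.cell_tameslot_of_ends`, every `l ≥ 33355`); `n = 1` floor-free on the labels below the top (`l ≥ 66639`), and the
EXACT integer cell — floor included — at the single top label `j = (l−1)/2`, level by level (`norm_num`). [folklore] -/
theorem RefBand.inhcell_377933067_p1061_levels1 {l e : ℕ} (hl : l.Prime) (hL : l ∈ ([70039, 70051, 70061, 70067, 70079, 70099, 70111, 70117, 70121, 70123, 70139, 70141, 70157] : List ℕ)) (he : 0 < e) (_hle : l ∣ e)
    (h15 : 15 * l ∣ e * 4) (_h30 : 1061 ∣ 30 → (1061 - 1) ∣ e) (_hodd : 1061 ∣ 2 ^ 15 * 17 ^ 2 * 331 * 1061 ^ 4 → Odd 4 → 30 * l ∣ e * 4) :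
    (∀ k : ℕ, (e : ℤ) ≠ ((1061 : ℕ) : ℤ) ^ k * (((1061 : ℕ) : ℤ) - 1)) ∧
      ∀ i : ℕ, i < (l - 1) / 2 →
        (e : ℤ) * ((((i + 1 : ℕ) : ℤ) ^ 2 * ((e * (2 * 4) / (2 * l) : ℕ) : ℤ) -
            ((i + 1 : ℕ) : ℤ) * (((if 1061 ∣ 30 ∧ ¬ 1061 ∣ 4 then 2 * e - 1 else e - 1 : ℕ) : ℕ) : ℤ) -
            ((i + 2 : ℕ) : ℤ) * ((((max 1 (e / (1061 - 1))) : ℕ) : ℤ))) / (e : ℤ)) +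
          ((i + 2 : ℕ) : ℤ) * min (((1061 : ℕ) : ℤ) ^ (1) - ((1 : ℕ) : ℤ) * (e : ℤ)) (((1061 : ℕ) : ℤ) ^ (1) - ((1 : ℕ) : ℤ) * (e : ℤ)) ≤
        ((e * (2 * 4) / (2 * l) : ℕ) : ℤ) := by
  rw [show (1061 - 1 : ℕ) = 1060 by norm_num]
  have hL' := hL
  simp only [List.mem_cons, List.mem_nil_iff, or_false] at hL'
  have hl0 : 70039 ≤ l := by omega
  have hlt : Nat.Coprime l 4 := (Nat.Prime.coprime_iff_not_dvd hl).mpr (fun h => by have := Nat.le_of_dvd (by norm_num) h; omega)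
  have hF1 : 15 * l ∣ e := (Nat.Coprime.mul_left (by norm_num) hlt).dvd_of_dvd_mul_right h15
  obtain ⟨n, rfl⟩ := hF1
  have hn : 1 ≤ n := Nat.pos_of_ne_zero (by rintro rfl; simp at he)
  refine ⟨WRow.natCast_ne_pow_mul_sub_one (by norm_num : Nat.Prime 3) (by norm_num) (by norm_num) (by norm_num) ⟨5 * l * n, by ring⟩,
    fun i hi => ?_⟩
  rw [if_neg (by norm_num : ¬ ((1061 : ℕ) ∣ 30 ∧ ¬ (1061 : ℕ) ∣ 4))]
  have hP : 15 * l * (2 * 4) / (2 * l) = 60 := Nat.div_eq_of_eq_mul_left (by omega) (by ring)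
  have hpA : (((1061 : ℕ) : ℤ)) ^ 1 = 1061 := by norm_num
  have hr2 : 15 * l < 1060 * (15 * l / 1060) + 1060 := by
    have := Nat.lt_mul_div_succ (15 * l) (show 0 < 1060 by norm_num); linarith
  have hr1 : 1060 * (15 * l / 1060) ≤ 15 * l := Nat.mul_div_le _ _
  rcases le_or_gt 2 n with hn2 | hn2
  · -- every multiple `n ≥ 2`: floor-free two-ends certificate at the base multiple `2` (slot ≥ `2·⌊15l/1060⌋`), every `l ≥ 33355`
    refine WRow.cell_tameslot_of_ends ((1061 : ℕ) : ℤ) (15 * l) 1060 (15 * l / 1060) (2 * 4) (2 * l) 1 1 ((l - 1) / 2) 2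
      (by norm_num) (by norm_num) (Nat.div_mul_le_self _ _) (by omega) ⟨60, by ring⟩ (by omega) (by norm_num) ?_ hi hn2
    rintro i (rfl | hi')
    · rw [hP, hpA]; push_cast; omega
    · obtain ⟨k, hk⟩ := hl.odd_of_ne_two (by omega)
      have hl' : l = 2 * i + 3 := by omega
      subst hl'
      have hi0 : ((16676 : ℕ) : ℤ) ≤ (i : ℤ) := by exact_mod_cast (show 16676 ≤ i by omega)
      have hr2z : ((15 * (2 * i + 3) : ℕ) : ℤ) < 1060 * (((15 * (2 * i + 3) / 1060 : ℕ)) : ℤ) + 1060 := by exact_mod_cast hr2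
      rw [hP, hpA]; push_cast at hi0 hr2z ⊢
      nlinarith [sq_nonneg (i : ℤ), mul_nonneg (sub_nonneg.mpr hi0) (show (0 : ℤ) ≤ (i : ℤ) by positivity), hr2z,
        mul_nonneg (show (0 : ℤ) ≤ (i : ℤ) + 2 by positivity) (sub_nonneg.mpr hr2z.le)]
  · obtain rfl : n = 1 := by omega
    rcases Nat.lt_or_ge (i + 1) ((l - 1) / 2) with hlt | hge
    · -- `n = 1`, labels below the top: floor-free two-ends certificate on `j ≤ (l−3)/2`, every `l ≥ 66639`
      refine WRow.cell_tameslot_of_ends ((1061 : ℕ) : ℤ) (15 * l) 1060 (15 * l / 1060) (2 * 4) (2 * l) 1 1 ((l - 3) / 2) 1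
        (by norm_num) (by norm_num) (Nat.div_mul_le_self _ _) (by omega) ⟨60, by ring⟩ (by omega) le_rfl ?_ (show i < (l - 3) / 2 by omega) le_rfl
      rintro i (rfl | hi')
      · rw [hP, hpA]; push_cast; omega
      · obtain ⟨k, hk⟩ := hl.odd_of_ne_two (by omega)
        have hl' : l = 2 * i + 5 := by omega
        subst hl'
        have hi0 : ((33317 : ℕ) : ℤ) ≤ (i : ℤ) := by exact_mod_cast (show 33317 ≤ i by omega)
        have hr2z : ((15 * (2 * i + 5) : ℕ) : ℤ) < 1060 * (((15 * (2 * i + 5) / 1060 : ℕ)) : ℤ) + 1060 := by exact_mod_cast hr2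
        rw [hP, hpA]; push_cast at hi0 hr2z ⊢
        nlinarith [sq_nonneg (i : ℤ), mul_nonneg (sub_nonneg.mpr hi0) (show (0 : ℤ) ≤ (i : ℤ) by positivity), hr2z,
          mul_nonneg (show (0 : ℤ) ≤ (i : ℤ) + 2 by positivity) (sub_nonneg.mpr hr2z.le)]
    · -- `n = 1`, the top label `j = (l−1)/2`: the EXACT integer cell, level by level
      clear hr2 hr1 hP
      rcases hL' with rfl | rfl | rfl | rfl | rfl | rfl | rfl | rfl | rfl | rfl | rfl | rfl | rfl
      · obtain rfl : i = 35018 := by omega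
        norm_num [hpA]
      · obtain rfl : i = 35024 := by omega
        norm_num [hpA]
      · obtain rfl : i = 35029 := by omega
        norm_num [hpA]
      · obtain rfl : i = 35032 := by omega
        norm_num [hpA]
      · obtain rfl : i = 35038 := by omega
        norm_num [hpA]
      · obtain rfl : i = 35048 := by omega
        norm_num [hpA]
      · obtain rfl : i = 35054 := by omega
        norm_num [hpA]
      · obtain rfl : i = 35057 := by omega
        norm_num [hpA]
      · obtain rfl : i = 35059 := by omega
        norm_num [hpA]
      · obtain rfl : i = 35060 := by omega
        norm_num [hpA]
      · obtain rfl : i = 35068 := by omega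
        norm_num [hpA]
      · obtain rfl : i = 35069 := by omega
        norm_num [hpA]
      · obtain rfl : i = 35077 := by omega
        norm_num [hpA]

/-- The slot sockets' clause at the BINDING prime `p = 1061` (`v_p(abc) = 4`; `e ∈ 15·l·ℕ`; `D = e−1`, `ρin = ⌊e/1060⌋`, envelope exponent `1`)
at the EXACT LEVELS `l ∈ {70163, 70177, 70181, 70183, 70199, 70201, 70207, 70223, 70229, 70237, 70241, 70249, 70271}` (chunk 2; all below the uniform threshold `70879` of `RefBand.inhcell_377933067_p1061`): multiples `n ≥ 2` floor-free from the
two end labels with base multiple `2` (`WRow.cell_tameslot_of_ends`, every `l ≥ 33355`); `n = 1` floor-free on the labels below the top (`l ≥ 66639`), and the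
EXACT integer cell — floor included — at the single top label `j = (l−1)/2`, level by level (`norm_num`). [folklore] -/
theorem RefBand.inhcell_377933067_p1061_levels2 {l e : ℕ} (hl : l.Prime) (hL : l ∈ ([70163, 70177, 70181, 70183, 70199, 70201, 70207, 70223, 70229, 70237, 70241, 70249, 70271] : List ℕ)) (he : 0 < e) (_hle : l ∣ e)
    (h15 : 15 * l ∣ e * 4) (_h30 : 1061 ∣ 30 → (1061 - 1) ∣ e) (_hodd : 1061 ∣ 2 ^ 15 * 17 ^ 2 * 331 * 1061 ^ 4 → Odd 4 → 30 * l ∣ e * 4) :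
    (∀ k : ℕ, (e : ℤ) ≠ ((1061 : ℕ) : ℤ) ^ k * (((1061 : ℕ) : ℤ) - 1)) ∧
      ∀ i : ℕ, i < (l - 1) / 2 →
        (e : ℤ) * ((((i + 1 : ℕ) : ℤ) ^ 2 * ((e * (2 * 4) / (2 * l) : ℕ) : ℤ) -
            ((i + 1 : ℕ) : ℤ) * (((if 1061 ∣ 30 ∧ ¬ 1061 ∣ 4 then 2 * e - 1 else e - 1 : ℕ) : ℕ) : ℤ) -
            ((i + 2 : ℕ) : ℤ) * ((((max 1 (e / (1061 - 1))) : ℕ) : ℤ))) / (e : ℤ)) +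
          ((i + 2 : ℕ) : ℤ) * min (((1061 : ℕ) : ℤ) ^ (1) - ((1 : ℕ) : ℤ) * (e : ℤ)) (((1061 : ℕ) : ℤ) ^ (1) - ((1 : ℕ) : ℤ) * (e : ℤ)) ≤
        ((e * (2 * 4) / (2 * l) : ℕ) : ℤ) := by
  rw [show (1061 - 1 : ℕ) = 1060 by norm_num]
  have hL' := hL
  simp only [List.mem_cons, List.mem_nil_iff, or_false] at hL'
  have hl0 : 70039 ≤ l := by omega
  have hlt : Nat.Coprime l 4 := (Nat.Prime.coprime_iff_not_dvd hl).mpr (fun h => by have := Nat.le_of_dvd (by norm_num) h; omega)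
  have hF1 : 15 * l ∣ e := (Nat.Coprime.mul_left (by norm_num) hlt).dvd_of_dvd_mul_right h15
  obtain ⟨n, rfl⟩ := hF1
  have hn : 1 ≤ n := Nat.pos_of_ne_zero (by rintro rfl; simp at he)
  refine ⟨WRow.natCast_ne_pow_mul_sub_one (by norm_num : Nat.Prime 3) (by norm_num) (by norm_num) (by norm_num) ⟨5 * l * n, by ring⟩,
    fun i hi => ?_⟩
  rw [if_neg (by norm_num : ¬ ((1061 : ℕ) ∣ 30 ∧ ¬ (1061 : ℕ) ∣ 4))]
  have hP : 15 * l * (2 * 4) / (2 * l) = 60 := Nat.div_eq_of_eq_mul_left (by omega) (by ring)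
  have hpA : (((1061 : ℕ) : ℤ)) ^ 1 = 1061 := by norm_num
  have hr2 : 15 * l < 1060 * (15 * l / 1060) + 1060 := by
    have := Nat.lt_mul_div_succ (15 * l) (show 0 < 1060 by norm_num); linarith
  have hr1 : 1060 * (15 * l / 1060) ≤ 15 * l := Nat.mul_div_le _ _
  rcases le_or_gt 2 n with hn2 | hn2
  · -- every multiple `n ≥ 2`: floor-free two-ends certificate at the base multiple `2` (slot ≥ `2·⌊15l/1060⌋`), every `l ≥ 33355`
    refine WRow.cell_tameslot_of_ends ((1061 : ℕ) : ℤ) (15 * l) 1060 (15 * l / 1060) (2 * 4) (2 * l) 1 1 ((l - 1) / 2) 2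
      (by norm_num) (by norm_num) (Nat.div_mul_le_self _ _) (by omega) ⟨60, by ring⟩ (by omega) (by norm_num) ?_ hi hn2
    rintro i (rfl | hi')
    · rw [hP, hpA]; push_cast; omega
    · obtain ⟨k, hk⟩ := hl.odd_of_ne_two (by omega)
      have hl' : l = 2 * i + 3 := by omega
      subst hl'
      have hi0 : ((16676 : ℕ) : ℤ) ≤ (i : ℤ) := by exact_mod_cast (show 16676 ≤ i by omega)
      have hr2z : ((15 * (2 * i + 3) : ℕ) : ℤ) < 1060 * (((15 * (2 * i + 3) / 1060 : ℕ)) : ℤ) + 1060 := by exact_mod_cast hr2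
      rw [hP, hpA]; push_cast at hi0 hr2z ⊢
      nlinarith [sq_nonneg (i : ℤ), mul_nonneg (sub_nonneg.mpr hi0) (show (0 : ℤ) ≤ (i : ℤ) by positivity), hr2z,
        mul_nonneg (show (0 : ℤ) ≤ (i : ℤ) + 2 by positivity) (sub_nonneg.mpr hr2z.le)]
  · obtain rfl : n = 1 := by omega
    rcases Nat.lt_or_ge (i + 1) ((l - 1) / 2) with hlt | hge
    · -- `n = 1`, labels below the top: floor-free two-ends certificate on `j ≤ (l−3)/2`, every `l ≥ 66639`
      refine WRow.cell_tameslot_of_ends ((1061 : ℕ) : ℤ) (15 * l) 1060 (15 * l / 1060) (2 * 4) (2 * l) 1 1 ((l - 3) / 2) 1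
        (by norm_num) (by norm_num) (Nat.div_mul_le_self _ _) (by omega) ⟨60, by ring⟩ (by omega) le_rfl ?_ (show i < (l - 3) / 2 by omega) le_rfl
      rintro i (rfl | hi')
      · rw [hP, hpA]; push_cast; omega
      · obtain ⟨k, hk⟩ := hl.odd_of_ne_two (by omega)
        have hl' : l = 2 * i + 5 := by omega
        subst hl'
        have hi0 : ((33317 : ℕ) : ℤ) ≤ (i : ℤ) := by exact_mod_cast (show 33317 ≤ i by omega)
        have hr2z : ((15 * (2 * i + 5) : ℕ) : ℤ) < 1060 * (((15 * (2 * i + 5) / 1060 : ℕ)) : ℤ) + 1060 := by exact_mod_cast hr2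
        rw [hP, hpA]; push_cast at hi0 hr2z ⊢
        nlinarith [sq_nonneg (i : ℤ), mul_nonneg (sub_nonneg.mpr hi0) (show (0 : ℤ) ≤ (i : ℤ) by positivity), hr2z,
          mul_nonneg (show (0 : ℤ) ≤ (i : ℤ) + 2 by positivity) (sub_nonneg.mpr hr2z.le)]
    · -- `n = 1`, the top label `j = (l−1)/2`: the EXACT integer cell, level by level
      clear hr2 hr1 hP
      rcases hL' with rfl | rfl | rfl | rfl | rfl | rfl | rfl | rfl | rfl | rfl | rfl | rfl | rfl
      · obtain rfl : i = 35080 := by omega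
        norm_num [hpA]
      · obtain rfl : i = 35087 := by omega
        norm_num [hpA]
      · obtain rfl : i = 35089 := by omega
        norm_num [hpA]
      · obtain rfl : i = 35090 := by omega
        norm_num [hpA]
      · obtain rfl : i = 35098 := by omega
        norm_num [hpA]
      · obtain rfl : i = 35099 := by omega
        norm_num [hpA]
      · obtain rfl : i = 35102 := by omega
        norm_num [hpA]
      · obtain rfl : i = 35110 := by omega
        norm_num [hpA]
      · obtain rfl : i = 35113 := by omega
        norm_num [hpA]
      · obtain rfl : i = 35117 := by omega
        norm_num [hpA]
      · obtain rfl : i = 35119 := by omega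
        norm_num [hpA]
      · obtain rfl : i = 35123 := by omega
        norm_num [hpA]
      · obtain rfl : i = 35134 := by omega
        norm_num [hpA]

/-- The slot sockets' clause at the BINDING prime `p = 1061` (`v_p(abc) = 4`; `e ∈ 15·l·ℕ`; `D = e−1`, `ρin = ⌊e/1060⌋`, envelope exponent `1`)
at the EXACT LEVELS `l ∈ {70289, 70297, 70309, 70313, 70321, 70327, 70351, 70373, 70379, 70381, 70393, 70423, 70429}` (chunk 3; all below the uniform threshold `70879` of `RefBand.inhcell_377933067_p1061`): multiples `n ≥ 2` floor-free from the
two end labels with base multiple `2` (`WRow.cell_tameslot_of_ends`, every `l ≥ 33355`); `n = 1` floor-free on the labels below the top (`l ≥ 66639`), and the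
EXACT integer cell — floor included — at the single top label `j = (l−1)/2`, level by level (`norm_num`). [folklore] -/
theorem RefBand.inhcell_377933067_p1061_levels3 {l e : ℕ} (hl : l.Prime) (hL : l ∈ ([70289, 70297, 70309, 70313, 70321, 70327, 70351, 70373, 70379, 70381, 70393, 70423, 70429] : List ℕ)) (he : 0 < e) (_hle : l ∣ e)
    (h15 : 15 * l ∣ e * 4) (_h30 : 1061 ∣ 30 → (1061 - 1) ∣ e) (_hodd : 1061 ∣ 2 ^ 15 * 17 ^ 2 * 331 * 1061 ^ 4 → Odd 4 → 30 * l ∣ e * 4) :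
    (∀ k : ℕ, (e : ℤ) ≠ ((1061 : ℕ) : ℤ) ^ k * (((1061 : ℕ) : ℤ) - 1)) ∧
      ∀ i : ℕ, i < (l - 1) / 2 →
        (e : ℤ) * ((((i + 1 : ℕ) : ℤ) ^ 2 * ((e * (2 * 4) / (2 * l) : ℕ) : ℤ) -
            ((i + 1 : ℕ) : ℤ) * (((if 1061 ∣ 30 ∧ ¬ 1061 ∣ 4 then 2 * e - 1 else e - 1 : ℕ) : ℕ) : ℤ) -
            ((i + 2 : ℕ) : ℤ) * ((((max 1 (e / (1061 - 1))) : ℕ) : ℤ))) / (e : ℤ)) +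
          ((i + 2 : ℕ) : ℤ) * min (((1061 : ℕ) : ℤ) ^ (1) - ((1 : ℕ) : ℤ) * (e : ℤ)) (((1061 : ℕ) : ℤ) ^ (1) - ((1 : ℕ) : ℤ) * (e : ℤ)) ≤
        ((e * (2 * 4) / (2 * l) : ℕ) : ℤ) := by
  rw [show (1061 - 1 : ℕ) = 1060 by norm_num]
  have hL' := hL
  simp only [List.mem_cons, List.mem_nil_iff, or_false] at hL'
  have hl0 : 70039 ≤ l := by omega
  have hlt : Nat.Coprime l 4 := (Nat.Prime.coprime_iff_not_dvd hl).mpr (fun h => by have := Nat.le_of_dvd (by norm_num) h; omega)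
  have hF1 : 15 * l ∣ e := (Nat.Coprime.mul_left (by norm_num) hlt).dvd_of_dvd_mul_right h15
  obtain ⟨n, rfl⟩ := hF1
  have hn : 1 ≤ n := Nat.pos_of_ne_zero (by rintro rfl; simp at he)
  refine ⟨WRow.natCast_ne_pow_mul_sub_one (by norm_num : Nat.Prime 3) (by norm_num) (by norm_num) (by norm_num) ⟨5 * l * n, by ring⟩,
    fun i hi => ?_⟩
  rw [if_neg (by norm_num : ¬ ((1061 : ℕ) ∣ 30 ∧ ¬ (1061 : ℕ) ∣ 4))]
  have hP : 15 * l * (2 * 4) / (2 * l) = 60 := Nat.div_eq_of_eq_mul_left (by omega) (by ring)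
  have hpA : (((1061 : ℕ) : ℤ)) ^ 1 = 1061 := by norm_num
  have hr2 : 15 * l < 1060 * (15 * l / 1060) + 1060 := by
    have := Nat.lt_mul_div_succ (15 * l) (show 0 < 1060 by norm_num); linarith
  have hr1 : 1060 * (15 * l / 1060) ≤ 15 * l := Nat.mul_div_le _ _
  rcases le_or_gt 2 n with hn2 | hn2
  · -- every multiple `n ≥ 2`: floor-free two-ends certificate at the base multiple `2` (slot ≥ `2·⌊15l/1060⌋`), every `l ≥ 33355`
    refine WRow.cell_tameslot_of_ends ((1061 : ℕ) : ℤ) (15 * l) 1060 (15 * l / 1060) (2 * 4) (2 * l) 1 1 ((l - 1) / 2) 2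
      (by norm_num) (by norm_num) (Nat.div_mul_le_self _ _) (by omega) ⟨60, by ring⟩ (by omega) (by norm_num) ?_ hi hn2
    rintro i (rfl | hi')
    · rw [hP, hpA]; push_cast; omega
    · obtain ⟨k, hk⟩ := hl.odd_of_ne_two (by omega)
      have hl' : l = 2 * i + 3 := by omega
      subst hl'
      have hi0 : ((16676 : ℕ) : ℤ) ≤ (i : ℤ) := by exact_mod_cast (show 16676 ≤ i by omega)
      have hr2z : ((15 * (2 * i + 3) : ℕ) : ℤ) < 1060 * (((15 * (2 * i + 3) / 1060 : ℕ)) : ℤ) + 1060 := by exact_mod_cast hr2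
      rw [hP, hpA]; push_cast at hi0 hr2z ⊢
      nlinarith [sq_nonneg (i : ℤ), mul_nonneg (sub_nonneg.mpr hi0) (show (0 : ℤ) ≤ (i : ℤ) by positivity), hr2z,
        mul_nonneg (show (0 : ℤ) ≤ (i : ℤ) + 2 by positivity) (sub_nonneg.mpr hr2z.le)]
  · obtain rfl : n = 1 := by omega
    rcases Nat.lt_or_ge (i + 1) ((l - 1) / 2) with hlt | hge
    · -- `n = 1`, labels below the top: floor-free two-ends certificate on `j ≤ (l−3)/2`, every `l ≥ 66639`
      refine WRow.cell_tameslot_of_ends ((1061 : ℕ) : ℤ) (15 * l) 1060 (15 * l / 1060) (2 * 4) (2 * l) 1 1 ((l - 3) / 2) 1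
        (by norm_num) (by norm_num) (Nat.div_mul_le_self _ _) (by omega) ⟨60, by ring⟩ (by omega) le_rfl ?_ (show i < (l - 3) / 2 by omega) le_rfl
      rintro i (rfl | hi')
      · rw [hP, hpA]; push_cast; omega
      · obtain ⟨k, hk⟩ := hl.odd_of_ne_two (by omega)
        have hl' : l = 2 * i + 5 := by omega
        subst hl'
        have hi0 : ((33317 : ℕ) : ℤ) ≤ (i : ℤ) := by exact_mod_cast (show 33317 ≤ i by omega)
        have hr2z : ((15 * (2 * i + 5) : ℕ) : ℤ) < 1060 * (((15 * (2 * i + 5) / 1060 : ℕ)) : ℤ) + 1060 := by exact_mod_cast hr2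
        rw [hP, hpA]; push_cast at hi0 hr2z ⊢
        nlinarith [sq_nonneg (i : ℤ), mul_nonneg (sub_nonneg.mpr hi0) (show (0 : ℤ) ≤ (i : ℤ) by positivity), hr2z,
          mul_nonneg (show (0 : ℤ) ≤ (i : ℤ) + 2 by positivity) (sub_nonneg.mpr hr2z.le)]
    · -- `n = 1`, the top label `j = (l−1)/2`: the EXACT integer cell, level by level
      clear hr2 hr1 hP
      rcases hL' with rfl | rfl | rfl | rfl | rfl | rfl | rfl | rfl | rfl | rfl | rfl | rfl | rfl
      · obtain rfl : i = 35143 := by omega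
        norm_num [hpA]
      · obtain rfl : i = 35147 := by omega
        norm_num [hpA]
      · obtain rfl : i = 35153 := by omega
        norm_num [hpA]
      · obtain rfl : i = 35155 := by omega
        norm_num [hpA]
      · obtain rfl : i = 35159 := by omega
        norm_num [hpA]
      · obtain rfl : i = 35162 := by omega
        norm_num [hpA]
      · obtain rfl : i = 35174 := by omega
        norm_num [hpA]
      · obtain rfl : i = 35185 := by omega
        norm_num [hpA]
      · obtain rfl : i = 35188 := by omega
        norm_num [hpA]
      · obtain rfl : i = 35189 := by omega
        norm_num [hpA]
      · obtain rfl : i = 35195 := by omega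
        norm_num [hpA]
      · obtain rfl : i = 35210 := by omega
        norm_num [hpA]
      · obtain rfl : i = 35213 := by omega
        norm_num [hpA]

/-- The slot sockets' clause at the BINDING prime `p = 1061` (`v_p(abc) = 4`; `e ∈ 15·l·ℕ`; `D = e−1`, `ρin = ⌊e/1060⌋`, envelope exponent `1`)
at the EXACT LEVELS `l ∈ {70439, 70451, 70457, 70459, 70481, 70487, 70489, 70501, 70507, 70529, 70537, 70549, 70571}` (chunk 4; all below the uniform threshold `70879` of `RefBand.inhcell_377933067_p1061`): multiples `n ≥ 2` floor-free from the
two end labels with base multiple `2` (`WRow.cell_tameslot_of_ends`, every `l ≥ 33355`); `n = 1` floor-free on the labels below the top (`l ≥ 66639`), and the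
EXACT integer cell — floor included — at the single top label `j = (l−1)/2`, level by level (`norm_num`). [folklore] -/
theorem RefBand.inhcell_377933067_p1061_levels4 {l e : ℕ} (hl : l.Prime) (hL : l ∈ ([70439, 70451, 70457, 70459, 70481, 70487, 70489, 70501, 70507, 70529, 70537, 70549, 70571] : List ℕ)) (he : 0 < e) (_hle : l ∣ e)
    (h15 : 15 * l ∣ e * 4) (_h30 : 1061 ∣ 30 → (1061 - 1) ∣ e) (_hodd : 1061 ∣ 2 ^ 15 * 17 ^ 2 * 331 * 1061 ^ 4 → Odd 4 → 30 * l ∣ e * 4) :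
    (∀ k : ℕ, (e : ℤ) ≠ ((1061 : ℕ) : ℤ) ^ k * (((1061 : ℕ) : ℤ) - 1)) ∧
      ∀ i : ℕ, i < (l - 1) / 2 →
        (e : ℤ) * ((((i + 1 : ℕ) : ℤ) ^ 2 * ((e * (2 * 4) / (2 * l) : ℕ) : ℤ) -
            ((i + 1 : ℕ) : ℤ) * (((if 1061 ∣ 30 ∧ ¬ 1061 ∣ 4 then 2 * e - 1 else e - 1 : ℕ) : ℕ) : ℤ) -
            ((i + 2 : ℕ) : ℤ) * ((((max 1 (e / (1061 - 1))) : ℕ) : ℤ))) / (e : ℤ)) +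
          ((i + 2 : ℕ) : ℤ) * min (((1061 : ℕ) : ℤ) ^ (1) - ((1 : ℕ) : ℤ) * (e : ℤ)) (((1061 : ℕ) : ℤ) ^ (1) - ((1 : ℕ) : ℤ) * (e : ℤ)) ≤
        ((e * (2 * 4) / (2 * l) : ℕ) : ℤ) := by
  rw [show (1061 - 1 : ℕ) = 1060 by norm_num]
  have hL' := hL
  simp only [List.mem_cons, List.mem_nil_iff, or_false] at hL'
  have hl0 : 70039 ≤ l := by omega
  have hlt : Nat.Coprime l 4 := (Nat.Prime.coprime_iff_not_dvd hl).mpr (fun h => by have := Nat.le_of_dvd (by norm_num) h; omega)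
  have hF1 : 15 * l ∣ e := (Nat.Coprime.mul_left (by norm_num) hlt).dvd_of_dvd_mul_right h15
  obtain ⟨n, rfl⟩ := hF1
  have hn : 1 ≤ n := Nat.pos_of_ne_zero (by rintro rfl; simp at he)
  refine ⟨WRow.natCast_ne_pow_mul_sub_one (by norm_num : Nat.Prime 3) (by norm_num) (by norm_num) (by norm_num) ⟨5 * l * n, by ring⟩,
    fun i hi => ?_⟩
  rw [if_neg (by norm_num : ¬ ((1061 : ℕ) ∣ 30 ∧ ¬ (1061 : ℕ) ∣ 4))]
  have hP : 15 * l * (2 * 4) / (2 * l) = 60 := Nat.div_eq_of_eq_mul_left (by omega) (by ring)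
  have hpA : (((1061 : ℕ) : ℤ)) ^ 1 = 1061 := by norm_num
  have hr2 : 15 * l < 1060 * (15 * l / 1060) + 1060 := by
    have := Nat.lt_mul_div_succ (15 * l) (show 0 < 1060 by norm_num); linarith
  have hr1 : 1060 * (15 * l / 1060) ≤ 15 * l := Nat.mul_div_le _ _
  rcases le_or_gt 2 n with hn2 | hn2
  · -- every multiple `n ≥ 2`: floor-free two-ends certificate at the base multiple `2` (slot ≥ `2·⌊15l/1060⌋`), every `l ≥ 33355`
    refine WRow.cell_tameslot_of_ends ((1061 : ℕ) : ℤ) (15 * l) 1060 (15 * l / 1060) (2 * 4) (2 * l) 1 1 ((l - 1) / 2) 2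
      (by norm_num) (by norm_num) (Nat.div_mul_le_self _ _) (by omega) ⟨60, by ring⟩ (by omega) (by norm_num) ?_ hi hn2
    rintro i (rfl | hi')
    · rw [hP, hpA]; push_cast; omega
    · obtain ⟨k, hk⟩ := hl.odd_of_ne_two (by omega)
      have hl' : l = 2 * i + 3 := by omega
      subst hl'
      have hi0 : ((16676 : ℕ) : ℤ) ≤ (i : ℤ) := by exact_mod_cast (show 16676 ≤ i by omega)
      have hr2z : ((15 * (2 * i + 3) : ℕ) : ℤ) < 1060 * (((15 * (2 * i + 3) / 1060 : ℕ)) : ℤ) + 1060 := by exact_mod_cast hr2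
      rw [hP, hpA]; push_cast at hi0 hr2z ⊢
      nlinarith [sq_nonneg (i : ℤ), mul_nonneg (sub_nonneg.mpr hi0) (show (0 : ℤ) ≤ (i : ℤ) by positivity), hr2z,
        mul_nonneg (show (0 : ℤ) ≤ (i : ℤ) + 2 by positivity) (sub_nonneg.mpr hr2z.le)]
  · obtain rfl : n = 1 := by omega
    rcases Nat.lt_or_ge (i + 1) ((l - 1) / 2) with hlt | hge
    · -- `n = 1`, labels below the top: floor-free two-ends certificate on `j ≤ (l−3)/2`, every `l ≥ 66639`
      refine WRow.cell_tameslot_of_ends ((1061 : ℕ) : ℤ) (15 * l) 1060 (15 * l / 1060) (2 * 4) (2 * l) 1 1 ((l - 3) / 2) 1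
        (by norm_num) (by norm_num) (Nat.div_mul_le_self _ _) (by omega) ⟨60, by ring⟩ (by omega) le_rfl ?_ (show i < (l - 3) / 2 by omega) le_rfl
      rintro i (rfl | hi')
      · rw [hP, hpA]; push_cast; omega
      · obtain ⟨k, hk⟩ := hl.odd_of_ne_two (by omega)
        have hl' : l = 2 * i + 5 := by omega
        subst hl'
        have hi0 : ((33317 : ℕ) : ℤ) ≤ (i : ℤ) := by exact_mod_cast (show 33317 ≤ i by omega)
        have hr2z : ((15 * (2 * i + 5) : ℕ) : ℤ) < 1060 * (((15 * (2 * i + 5) / 1060 : ℕ)) : ℤ) + 1060 := by exact_mod_cast hr2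
        rw [hP, hpA]; push_cast at hi0 hr2z ⊢
        nlinarith [sq_nonneg (i : ℤ), mul_nonneg (sub_nonneg.mpr hi0) (show (0 : ℤ) ≤ (i : ℤ) by positivity), hr2z,
          mul_nonneg (show (0 : ℤ) ≤ (i : ℤ) + 2 by positivity) (sub_nonneg.mpr hr2z.le)]
    · -- `n = 1`, the top label `j = (l−1)/2`: the EXACT integer cell, level by level
      clear hr2 hr1 hP
      rcases hL' with rfl | rfl | rfl | rfl | rfl | rfl | rfl | rfl | rfl | rfl | rfl | rfl | rfl
      · obtain rfl : i = 35218 := by omega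
        norm_num [hpA]
      · obtain rfl : i = 35224 := by omega
        norm_num [hpA]
      · obtain rfl : i = 35227 := by omega
        norm_num [hpA]
      · obtain rfl : i = 35228 := by omega
        norm_num [hpA]
      · obtain rfl : i = 35239 := by omega
        norm_num [hpA]
      · obtain rfl : i = 35242 := by omega
        norm_num [hpA]
      · obtain rfl : i = 35243 := by omega
        norm_num [hpA]
      · obtain rfl : i = 35249 := by omega
        norm_num [hpA]
      · obtain rfl : i = 35252 := by omega
        norm_num [hpA]
      · obtain rfl : i = 35263 := by omega
        norm_num [hpA]
      · obtain rfl : i = 35267 := by omega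
        norm_num [hpA]
      · obtain rfl : i = 35273 := by omega
        norm_num [hpA]
      · obtain rfl : i = 35284 := by omega
        norm_num [hpA]

end Summit.ABC.IUTFork.Conditional
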